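import Literature.Analysis.FluidPDE.NormalisedPressure
import Literature.Analysis.FluidPDE.TaoLocalisation
import Literature.Analysis.FluidPDE.NSUnconditionalUniqueness
import Literature.Analysis.FluidPDE.NSFiniteEnergySmooth
import HarnessLib

/-!
# The forced normalised pressure `-Δ⁻¹∂ᵢ∂ⱼ(uᵢuⱼ) + Δ⁻¹∇·f` and the forced twins of Tao's
# pressure-normalisation, unconditional-uniqueness and uniform-smoothness statements

Cell `pub/ns-blowup`, WANTED W14 (= refuter W-R3, assembly gap G-C1): the tree vendors Tao 2011
(`Tao2011` = arXiv:1108.1165; Anal. PDE 6 (2013)) only in the homogeneous case `f = 0`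
(`tao_pressure_normalisation`, `tao2011_boundedEnstrophy`, `tao2011_hasBoundedSobolevNormsOn`,
`isLerayHopfOn_of_finiteEnergy`, …), whereas an assembly of Fefferman's (C) (breakdown WITH a
smooth decaying force) needs the printed statements with their force slot. This file supplies:

* `forceKernel z v = ⟨z, v⟩/(ω_d |z|^d) = ∇Γ(z) · v` (`Γ` the Newtonian kernel, `ΔΓ = δ`) and the
  **force potential** `forcePotential f x = Δ⁻¹∇·f (x) = ∫ ∇Γ(x-y)·f(y) dy` of a force slice
  `f : E → E` (an absolutely convergent Lebesgue integral for `f ∈ C⁰ ∩ L²(ℝ³)`: the kernel is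
  `O(|z|^{1-d})`, locally integrable, and square integrable at infinity; documented junk value —
  Bochner `0` — off that class), so that Tao's normalised pressure (9)
  `p = -Δ⁻¹∂ᵢ∂ⱼ(uᵢuⱼ) + Δ⁻¹∇·f` reads `normalisedPressure (u t) x + forcePotential (f t) x`
  (`HasForcedNormalisedPressure u f p S`; for `f = 0` it implies the tree's per-time
  `HasNormalisedPressure u p S`, proved below);
* three NAMED FACTS (nothing asserted; users take `(h : X)`), each the statement AS PRINTED with
  the force `f` kept, rendered — exactly as the tree's `f = 0` versions — for viscosity `ν > 0`
  (Tao normalises `ν = 1`; reduce by `v(s,x) = ν⁻¹u(s/ν,x)`, `q = ν⁻²p(s/ν,x)`, `g = ν⁻²f(s/ν,x)`,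
  which preserves every class below) and for classical solutions jointly smooth on the CLOSED slab
  `[0,T] × ℝ³` (`IsClassicalNSSolutionOn (Icc 0 T) ν f u p`, a subclass of Tao's *almost smooth*
  solutions — so each fact is a special case of the printed one):
  - `tao2011_forced_pressure_normalisation` — **Lemma 4.1 (i)** (arXiv Lemma 25 (i)), p. 14:
    an almost smooth finite energy solution `(u,p,u₀,f,T)` has, for a.e. `t ∈ [0,T]`,
    `p(t,x) = -Δ⁻¹∂ᵢ∂ⱼ(uᵢuⱼ)(t,x) + Δ⁻¹∇·f(t,x) + C(t)` with `C` bounded measurable;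
    **ERRATUM (cell `pub/ns-blowup`, lit g8): this verbatim rendering is REFUTED as stated** —
    `not_tao2011_forced_pressure_normalisation` (`TaoForcedPressureNormalisationCounterexample.lean`,
    kernel-checked): the escaping-shell solution `u ≡ 0`, `p = q`, `f = ∇q`,
    `q(t,y) = t^{-1/4}(1 - β(t y))`, is a smooth finite-energy solution in Tao's sense (`f` smooth on
    the closed slab, `‖f‖_{L¹_tL²_x} < ∞`) with `p - p̃[u] - Δ⁻¹∇·f = t^{-1/4}` for every `t > 0`, so
    the printed conjunct "`C` bounded" fails in the finite-energy forced class (the printed proof's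
    "`p₀` is bounded on compact subsets of spacetime" needs `sup_t ‖f(t)‖_{L²} < ∞`, e.g. `H¹` data);
    the rest of the printed argument (a.e. constancy of the harmonic part) is unaffected and the paper
    only uses `∇p` (Remark 4.2 = arXiv Remark 26). USE `tao2011_forced_pressure_normalisation_ae`
    (same hypotheses; conclusion: `C` measurable and the a.e. representation, no boundedness);
  - `tao2011_forced_unconditionalUniqueness_velocity` — **Cor. 11.4** (arXiv Cor. 71), p. 36:
    for smooth `H¹` data `(u₀,f,T)` there is at most one almost smooth finite energy solution with
    this data and with normalised pressure — vendored, like the tree's `f = 0` twin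
    `tao_unconditional_uniqueness_velocity` (PROVED in the tree for `f = 0`,
    `NSUnconditionalUniquenessHolds.lean`), in the velocity form given by the printed proof, the
    printed form being derived (`tao2011_forced_unconditionalUniqueness_of_velocity`);
  - `tao2011_forced_uniformSmoothnessOutsideBall` — **Prop. 11.6** (arXiv Prop. 73), p. 36: an incomplete almost smooth `H¹` solution `(u,p,u₀,f,T⋆⁻)`
    with normalised pressure satisfies `u, p, f, ∂ₜu ∈ L^∞_t C^k_x([0,T⋆) × K)` for all `k` and all
    compact `K ⊆ ℝ³ ∖ B(0,R)`, for some ball `B(0,R)`.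
  Tao's data classes are written out inline in the tree's vocabulary: *finite energy solution*
  ((6)–(7) p. 3: `‖f‖_{L¹_t L²_x} < ∞`, `sup_t ∫|u(t)|² < ∞`), *`H¹` data*
  (`‖u₀‖_{H¹} + ‖f‖_{L^∞_t H¹_x} < ∞`, with `iteratedFDeriv` as in `MemSobolevX`), *`H¹`
  solution* (`u ∈ X¹([0,T] × ℝ³)`, `MemSobolevX 1 T u`), *incomplete solution* `(…, T⋆⁻)` (the
  restriction to every `[0,T]`, `T < T⋆`, is a solution; p. 17).

* a fourth NAMED FACT, `tao2011_forced_finiteEnergy_energyBound` — **Lemma 8.1** (arXiv Lemma 44,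
  global energy inequality), p. 24: a finite energy almost smooth solution `(u,p,u₀,f,T)` obeys
  `‖u‖_{L^∞_tL²_x} + ‖∇u‖_{L²_tL²_x} ≲ E(u₀,f,T)^{1/2}`, `E(u₀,f,T) = ½(‖u₀‖_{L²} + ‖f‖_{L¹_tL²_x})²`
  ((8) p. 3), absolute constant — the forced twin of the tree's PROVED `f = 0` fact
  `tao_finite_energy_smooth_energy_bound` (`NSFiniteEnergySmooth.lean`, proof
  `NSFiniteEnergySmoothProofs.lean`), which it implies (`…energyBound.force_zero`, proved). Cell
  `pub/ns-blowup` LIT-DOSSIER §41 / planner WORD (STATUS l.1312): with `tao2011_forced_pressure_normalisation`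
  this is the printed input of «smooth + finite energy ⇒ Leray–Hopf with the energy inequality» for the
  forced system (the forced twin of `isLerayHopfOn_of_finiteEnergy`, `TaoFiniteEnergyLerayHopf.lean` — a
  THEOREM to be proved from these facts, not vendored), which feeds the forced Serrin–Masuda weak–strong
  uniqueness `sohr2001_serrinMasuda_uniqueness_forced` (`ForcedSerrinMasudaUniqueness.lean`).

The remaining links of a forced twin of the tree's `f = 0` chain (Cor. 11.1 / arXiv Cor. 68 bounded
enstrophy, Prop. 9.1 / arXiv Prop. 52 bounded total speed, Thm. 10.1 / arXiv Thm. 59 enstrophy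
localisation, Cor. 4.3 / arXiv Cor. 27, Thm. 5.4 / arXiv Thm. "lwp-h1-r3") are NOT vendored here.

## Mathlib / tree search

Tree: `normalisedPressure`, `HasNormalisedPressure`, `tao_pressure_normalisation` (`f = 0`,
`NormalisedPressure.lean`); `tao_unconditional_uniqueness(_velocity)` (`f = 0`, Cor. 11.4,
`NSUnconditionalUniqueness.lean`, proved in `NSUnconditionalUniquenessHolds.lean`); `MemSobolevX`, `tao2011_boundedEnstrophy` (`f = 0`,
`TaoLocalisation.lean`); `tao_finite_energy_smooth_energy_bound` (`f = 0`, Lemma 8.1,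
`NSFiniteEnergySmooth.lean`, proved in `NSFiniteEnergySmoothProofs.lean`); `IsClassicalNSSolutionOn S ν f u p` has the force slot already
(`ClassicalSolution.lean`). No `Δ⁻¹∇·`/Newtonian-gradient operator on force slices in the tree
(`lean search 'forcePotential|newtonGradient|inverseLaplacianDiv'`: only the torus weak
potential `Torus.exists_forcePotential` of `TorusForcePotential.lean`, a different object). Mathlib: Bochner
`integral`, `iteratedFDeriv`, `Metric.ball`.

## References

* T. Tao, *Localisation and compactness properties of the Navier–Stokes global regularity
  problem*, arXiv:1108.1165 = Anal. PDE 6 (2013) 25–107 (`Tao2011`): Def. 1.1 and (6)–(9)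
  pp. 3–5; Lemma 4.1 (arXiv Lemma 25) and Remark 4.2 (arXiv Remark 26), p. 14; §5 p. 17
  (incomplete solutions); §8 Lemma 44 (global energy inequality, journal Lemma 8.1), p. 24; §11: Cor. 68 (bounded enstrophy), Cor. 71 (unconditional uniqueness),
  Prop. 73 (uniform smoothness outside a ball) and Remarks 74–75, pp. 36–37 (arXiv numbering =
  journal Cor. 11.1, Cor. 11.4, Prop. 11.6, Remarks 11.7–11.8;
  held copy `paper:arxiv-1108.1165`, chunks p0003–p0005, p0014, p0017, p0024, p0036–p0037).
* D. Gilbarg, N. Trudinger, *Elliptic PDE of second order*, (2.12)–(2.13) (Newtonian kernel and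
  its gradient).
-/

noncomputable section

open MeasureTheory Set Filter Metric Topology
open scoped ENNReal NNReal RealInnerProductSpace ContDiff

namespace Literature.Analysis.FluidPDE

section Kernel

variable {E : Type*} [NormedAddCommGroup E] [InnerProductSpace ℝ E] [FiniteDimensional ℝ E]
  [MeasurableSpace E] [BorelSpace E]

/-- **The gradient of the Newtonian kernel contracted with a vector**:
`forceKernel z v = ∇Γ(z) · v = ⟨z, v⟩/(ω_d |z|^d)` (`Γ(z) = |z|^{2-d}/((2-d)ω_d)`, `ΔΓ = δ`,
`ω_d = |S^{d-1}|` = `unitSphereArea E`), so that `Δ⁻¹∇·f (x) = ∫ forceKernel (x - y) (f y) dy`.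
Value `0` at `z = 0`. [Gilbarg–Trudinger (2.12)–(2.13); Tao 2011, (9)] [folklore] -/
def forceKernel (z v : E) : ℝ :=
  ⟪z, v⟫ / (unitSphereArea E * ‖z‖ ^ Module.finrank ℝ E)

/-- `forceKernel 0 v = 0` (junk value on the diagonal). [cite: Tao2011, (9) p. 5] -/
@[simp] theorem forceKernel_zero_left (v : E) : forceKernel (0 : E) v = 0 := by
  simp [forceKernel]

/-- `forceKernel z 0 = 0`. [cite: Tao2011, (9) p. 5] -/
@[simp] theorem forceKernel_zero_right (z : E) : forceKernel z (0 : E) = 0 := by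
  simp [forceKernel]

/-- The kernel is linear in the force slot: `forceKernel z (c • v) = c * forceKernel z v`
(linearity of `Δ⁻¹∇·`, used in the viscosity rescaling `g = ν⁻²f(s/ν,·)`). [cite: Tao2011, (9) p. 5 and (31)] -/
theorem forceKernel_smul_right (z v : E) (c : ℝ) :
    forceKernel z (c • v) = c * forceKernel z v := by
  simp only [forceKernel, inner_smul_right]
  ring

/-- On `ℝ³`: `forceKernel z v = ⟨z, v⟩/(4π|z|³)`, the kernel of `Δ⁻¹∇·`. [cite: Tao2011, (9) p. 5] -/
theorem forceKernel_eq_fin3 (z v : EuclideanSpace ℝ (Fin 3)) :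
    forceKernel z v = ⟪z, v⟫ / (4 * Real.pi * ‖z‖ ^ 3) := by
  rw [forceKernel, unitSphereArea_fin3, finrank_euclideanSpace_fin]

/-- **The force potential** `Δ⁻¹∇·f (x) = ∫ ∇Γ(x - y) · f(y) dy = ∫ forceKernel (x - y) (f y) dy`
of a force slice `f : E → E` — the second term of Tao's normalised pressure (9),
`p = -Δ⁻¹∂ᵢ∂ⱼ(uᵢuⱼ) + Δ⁻¹∇·f` ("`∇·f` is the first derivative of an `L²_x(ℝ³)` function", p. 5).
Bochner integral: for `f` continuous and square integrable on `ℝ³` the integrand is absolutely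
integrable (`|forceKernel (x-y) (f y)| ≤ |f y|/(4π|x-y|²)`, locally integrable near `y = x` and,
at infinity, the product of two `L²` functions); off that class the value is the documented junk
`0` of `integral_undef`. [cite: Tao2011, (9) p. 5] -/
def forcePotential (f : E → E) (x : E) : ℝ :=
  ∫ y, forceKernel (x - y) (f y)

/-- `Δ⁻¹∇·0 = 0`: for `f = 0` the forced normalisation (9) is the homogeneous one. [cite: Tao2011, (9) p. 5] -/
@[simp] theorem forcePotential_zero : forcePotential (0 : E → E) = 0 := by
  funext x
  simp [forcePotential]

/-- **Normalised pressure with force** (Tao 2011, (9), imposed on a time set `S`):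
`p(t, x) = -Δ⁻¹∂ᵢ∂ⱼ(uᵢuⱼ)(t, x) + Δ⁻¹∇·f(t, x)` for all `t ∈ S` and all `x`, i.e.
`p t x = normalisedPressure (u t) x + forcePotential (f t) x`. This is the hypothesis
"with normalised pressure" of Cor. 71 and Prop. 73 (arXiv numbering). [cite: Tao2011, (9) p. 5] -/
def HasForcedNormalisedPressure (u f : ℝ → E → E) (p : ℝ → E → ℝ) (S : Set ℝ) : Prop :=
  ∀ t ∈ S, ∀ x, p t x = normalisedPressure (u t) x + forcePotential (f t) x

/-- `HasForcedNormalisedPressure` is antitone in the time set (restriction of a solution with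
normalised pressure to a shorter slab, as in the definition of incomplete solutions, p. 17). [cite: Tao2011, (9) p. 5] -/
theorem HasForcedNormalisedPressure.mono {u f : ℝ → E → E} {p : ℝ → E → ℝ} {S S' : Set ℝ}
    (h : HasForcedNormalisedPressure u f p S) (hS : S' ⊆ S) :
    HasForcedNormalisedPressure u f p S' :=
  fun t ht ↦ h t (hS ht)

/-- In the homogeneous case `f = 0` the forced normalisation is the tree's per-time normalisation
(`HasNormalisedPressure`, with constant `c(t) = 0`). [cite: Tao2011, (9) p. 5] -/
theorem HasForcedNormalisedPressure.hasNormalisedPressure_of_force_zero {u : ℝ → E → E}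
    {p : ℝ → E → ℝ} {S : Set ℝ} (h : HasForcedNormalisedPressure u 0 p S) :
    HasNormalisedPressure u p S := by
  intro t ht
  refine ⟨0, fun x ↦ ?_⟩
  have := h t ht x
  simpa using this

/-- The pair `(u, -Δ⁻¹∂ᵢ∂ⱼ(uᵢuⱼ) + Δ⁻¹∇·f)` itself has normalised pressure (the pressure
`p̃` of Cor. 4.3). [cite: Tao2011, (9) p. 5 and Cor. 4.3] -/
theorem hasForcedNormalisedPressure_self (u f : ℝ → E → E) (S : Set ℝ) :
    HasForcedNormalisedPressure u f
      (fun t x ↦ normalisedPressure (u t) x + forcePotential (f t) x) S :=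
  fun _ _ _ ↦ rfl

end Kernel

/-! ### The forced twins (named facts, `ℝ³`) -/

/-- Local notation for physical space `ℝ³ = EuclideanSpace ℝ (Fin 3)`. -/
local notation "ℝ³" => EuclideanSpace ℝ (Fin 3)

/-- **Tao 2011, Lemma 4.1 (i) (arXiv Lemma 25 (i)) — reduction to normalised pressure, WITH
force.** Printed: "If `(u,p,u₀,f,T)` is an almost smooth finite energy solution, then for almost
every time `t ∈ [0,T]` one has `p(t,x) = -Δ⁻¹∂ᵢ∂ⱼ(uᵢuⱼ)(t,x) + Δ⁻¹∇·f(t,x) + C(t)` for some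
bounded measurable function `C : [0,T] → ℝ`." Rendered for `ν > 0` (rescaling, see the module
docstring) and for the subclass of classical solutions jointly smooth on the closed slab
`[0,T] × ℝ³` with smooth force (`IsSmoothSpaceTimeOn (Icc 0 T) f`, Def. 1.1), finite energy data
(`‖f‖_{L¹_t L²_x([0,T] × ℝ³)} < ∞`, (6)) and finite energy (`sup_{t ∈ [0,T]} ∫|u(t)|² < ∞`, (7)).
The `f = 0` case is the tree's `tao_pressure_normalisation`. Nothing asserted.
**REFUTED AS STATED** (the conjunct `∃ M, ∀ t ∈ [0,T], |C t| ≤ M`): see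
`not_tao2011_forced_pressure_normalisation` in `TaoForcedPressureNormalisationCounterexample.lean`
and the module docstring; anything proved from `(h : tao2011_forced_pressure_normalisation)` is
vacuous — use `tao2011_forced_pressure_normalisation_ae` below. The statement is kept unchanged
(declarations in the tree reference it) as the verbatim record of the print.
[cite: Tao2011, Lemma 4.1 (i) (arXiv Lemma 25 (i)), p. 14] -/
def tao2011_forced_pressure_normalisation : Prop :=
  ∀ ⦃ν T : ℝ⦄ (_hν : 0 < ν) (_hT : 0 < T) ⦃f u : ℝ → ℝ³ → ℝ³⦄ ⦃p : ℝ → ℝ³ → ℝ⦄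
    (_hsol : IsClassicalNSSolutionOn (Icc 0 T) ν f u p)
    (_hf : IsSmoothSpaceTimeOn (Icc 0 T) f)
    (_hfE : ∫⁻ t in Icc 0 T, (∫⁻ x, ‖f t x‖ₑ ^ 2) ^ (1 / 2 : ℝ) < ⊤)
    (_hE : ∃ C : ℝ≥0, ∀ t ∈ Icc 0 T, ∫⁻ x, ‖u t x‖ₑ ^ 2 ≤ C),
    ∃ C : ℝ → ℝ, Measurable C ∧ (∃ M : ℝ, ∀ t ∈ Icc 0 T, |C t| ≤ M) ∧
      ∀ᵐ t ∂(volume.restrict (Icc 0 T)), ∀ x,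
        p t x = normalisedPressure (u t) x + forcePotential (f t) x + C t

/-- **Tao 2011, Lemma 4.1 (i) (arXiv Lemma 25 (i)) WITH force — corrected conclusion.** Same
printed statement and same rendering as `tao2011_forced_pressure_normalisation` (`ν > 0` by
rescaling; classical solutions jointly smooth on the closed slab `[0,T] × ℝ³`; smooth force with
`‖f‖_{L¹_t L²_x([0,T] × ℝ³)} < ∞`, (6); `sup_{t ∈ [0,T]} ∫|u(t)|² < ∞`, (7)), with the conclusion
the printed PROOF delivers: there is a measurable `C : ℝ → ℝ` with
`p(t,x) = -Δ⁻¹∂ᵢ∂ⱼ(uᵢuⱼ)(t,x) + Δ⁻¹∇·f(t,x) + C(t)` for a.e. `t ∈ [0,T]` and all `x` (the harmonic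
part `h(t) = p(t) - p₀(t)` is constant in `x` for a.e. `t`: time-integrated momentum equation tested
against `R⁻³χ(x/R)`, the finite-energy bounds incl. `‖f‖_{L¹_tL²_x}`, the mean value property and
Lebesgue differentiation, arXiv pp. 14–15). The printed word "bounded" is NOT asserted: it is false
in this class (`not_tao2011_forced_pressure_normalisation`,
`TaoForcedPressureNormalisationCounterexample.lean`: `C(t) = t^{-1/4}` for the escaping shell); it
does hold when `sup_t ‖f(t)‖_{L²_x} < ∞` (e.g. Tao's `H¹` data), and `C ∈ L¹(0,T)` always — neither
refinement is asserted here. Only `∇p` is ever used downstream (Remark 4.2 = arXiv Remark 26: "we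
only need to understand the gradient `∇p` of the pressure"), so this is the statement the forced
Leray–Hopf packaging (cell `pub/ns-blowup`, PATH B) consumes. The `f = 0` case is implied by the
tree's PROVED `tao_pressure_normalisation` (which keeps the bounded `C`, true for `f = 0`).
Nothing asserted. [cite: Tao2011, Lemma 4.1 (i) (arXiv Lemma 25 (i)), p. 14] -/
def tao2011_forced_pressure_normalisation_ae : Prop :=
  ∀ ⦃ν T : ℝ⦄ (_hν : 0 < ν) (_hT : 0 < T) ⦃f u : ℝ → ℝ³ → ℝ³⦄ ⦃p : ℝ → ℝ³ → ℝ⦄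
    (_hsol : IsClassicalNSSolutionOn (Icc 0 T) ν f u p)
    (_hf : IsSmoothSpaceTimeOn (Icc 0 T) f)
    (_hfE : ∫⁻ t in Icc 0 T, (∫⁻ x, ‖f t x‖ₑ ^ 2) ^ (1 / 2 : ℝ) < ⊤)
    (_hE : ∃ C : ℝ≥0, ∀ t ∈ Icc 0 T, ∫⁻ x, ‖u t x‖ₑ ^ 2 ≤ C),
    ∃ C : ℝ → ℝ, Measurable C ∧
      ∀ᵐ t ∂(volume.restrict (Icc 0 T)), ∀ x,
        p t x = normalisedPressure (u t) x + forcePotential (f t) x + C t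

/-- **Tao 2011, Cor. 11.4 (arXiv Cor. 71), unconditional uniqueness, WITH force — velocity
form.** Printed: "Let `(u₀,f,T)` be smooth `H¹` data. Then there is at most one almost smooth
finite energy solution `(u,p,u₀,f,T)` with this data and with normalised pressure." As for the
tree's homogeneous twin `tao_unconditional_uniqueness_velocity` (whose docstring explains the
choice): the printed proof (Remark 11.3 = arXiv Remark 70: Cor. 11.1 bounded enstrophy ⇒ the
solution is `H¹`; Cor. 4.3: `(u, p̃)` with `p̃ = -Δ⁻¹∂ᵢ∂ⱼ(uᵢuⱼ) + Δ⁻¹∇·f` is `H¹` mild whatever the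
given pressure; Thm. 5.4 (iii): `H¹` mild solutions are unique) compares the VELOCITIES of two
solutions with arbitrary smooth pressures, the normalisation serving only to make "at most one
`(u,p)`" literally true; so the velocity statement is vendored and the printed form is derived
from it (`tao2011_forced_unconditionalUniqueness_of_velocity`, proved). Rendered for `ν > 0`
(rescaling) and the closed-slab classical subclass: smooth force with
`‖f‖_{L^∞_t H¹_x([0,T] × ℝ³)} < ∞` and datum `u(0) ∈ H¹` (smooth `H¹` data, Def. 1.1; hence finite
energy data), two solutions with the same datum and force, both of finite energy ((7)); then the
velocities coincide on `[0,T]`. Nothing asserted. [cite: Tao2011, Cor. 11.4 (arXiv Cor. 71), p. 36] -/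
def tao2011_forced_unconditionalUniqueness_velocity : Prop :=
  ∀ ⦃ν T : ℝ⦄ (_hν : 0 < ν) (_hT : 0 < T) ⦃f : ℝ → ℝ³ → ℝ³⦄
    (_hf : IsSmoothSpaceTimeOn (Icc 0 T) f)
    (_hfH1 : ∀ j ≤ 1, ∃ C : ℝ≥0, ∀ t ∈ Icc 0 T, ∫⁻ x, ‖iteratedFDeriv ℝ j (f t) x‖ₑ ^ 2 ≤ C)
    ⦃u v : ℝ → ℝ³ → ℝ³⦄ ⦃p q : ℝ → ℝ³ → ℝ⦄
    (_hu : IsClassicalNSSolutionOn (Icc 0 T) ν f u p)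
    (_hv : IsClassicalNSSolutionOn (Icc 0 T) ν f v q)
    (_h₀ : ∀ j ≤ 1, ∫⁻ x, ‖iteratedFDeriv ℝ j (u 0) x‖ₑ ^ 2 < ⊤)
    (_hdatum : v 0 = u 0)
    (_huE : ∃ C : ℝ≥0, ∀ t ∈ Icc 0 T, ∫⁻ x, ‖u t x‖ₑ ^ 2 ≤ C)
    (_hvE : ∃ C : ℝ≥0, ∀ t ∈ Icc 0 T, ∫⁻ x, ‖v t x‖ₑ ^ 2 ≤ C),
    ∀ t ∈ Icc 0 T, v t = u t

/-- **Tao 2011, Prop. 11.6 (arXiv Prop. 73), uniform smoothness outside a ball, WITH force.**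
Printed: "Let `(u,p,u₀,f,T⋆⁻)` be an incomplete almost smooth `H¹` solution with
normalised pressure for all times `0 < T < T⋆`. Then there exists a ball `B(0,R)` such that
`u, p, f, ∂ₜu ∈ L^∞_t C^k_x([0,T⋆) × K)` for all `k ≥ 0` and all compact subsets `K` of
`ℝ³ ∖ B(0,R)`." Rendered for `ν > 0` and the closed-slab classical subclass: `H¹` data on `[0,T⋆]`
(smooth force with `‖f‖_{L^∞_t H¹_x([0,T⋆] × ℝ³)} < ∞`, datum `u(0) ∈ H¹`); for every
`0 < T < T⋆` the restriction to `[0,T]` is a classical solution on the closed slab lying in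
`X¹([0,T] × ℝ³)` (`MemSobolevX 1 T u`, Tao's `H¹` solution, (7)); normalised pressure ((9)) on
`[0,T⋆)`. Conclusion: a radius `R` and, for each `k` and each compact `K ⊆ ℝ³ ∖ B(0,R)`, one
constant bounding the `k`-th spatial derivatives of `u`, `p`, `f` and `∂ₜu` (the time derivative
within the slab `[0,T]`) on `K`, uniformly in `0 ≤ t ≤ T < T⋆`. (Remark 11.8 = arXiv Remark 75:
no time derivative of `f` is used; Remark 11.7 = arXiv Remark 74: `u` extends continuously to
`{T⋆} × (ℝ³ ∖ B(0,R))`.) Nothing asserted. [cite: Tao2011, Prop. 11.6 (arXiv Prop. 73), p. 36] -/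
def tao2011_forced_uniformSmoothnessOutsideBall : Prop :=
  ∀ ⦃ν Tstar : ℝ⦄ (_hν : 0 < ν) (_hT : 0 < Tstar) ⦃f u : ℝ → ℝ³ → ℝ³⦄ ⦃p : ℝ → ℝ³ → ℝ⦄
    (_hf : IsSmoothSpaceTimeOn (Icc 0 Tstar) f)
    (_hfH1 : ∀ j ≤ 1, ∃ C : ℝ≥0, ∀ t ∈ Icc 0 Tstar, ∫⁻ x, ‖iteratedFDeriv ℝ j (f t) x‖ₑ ^ 2 ≤ C)
    (_h₀ : ∀ j ≤ 1, ∫⁻ x, ‖iteratedFDeriv ℝ j (u 0) x‖ₑ ^ 2 < ⊤)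
    (_hsol : ∀ T, 0 < T → T < Tstar → IsClassicalNSSolutionOn (Icc 0 T) ν f u p)
    (_hX1 : ∀ T, 0 < T → T < Tstar → MemSobolevX 1 T u)
    (_hp : HasForcedNormalisedPressure u f p (Ico 0 Tstar)),
    ∃ R : ℝ, 0 < R ∧ ∀ (k : ℕ) (K : Set ℝ³), IsCompact K → K ⊆ (Metric.ball (0 : ℝ³) R)ᶜ →
      ∃ C : ℝ, ∀ T, 0 < T → T < Tstar → ∀ t ∈ Icc 0 T, ∀ x ∈ K,
        ‖iteratedFDeriv ℝ k (u t) x‖ ≤ C ∧ ‖iteratedFDeriv ℝ k (p t) x‖ ≤ C ∧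
          ‖iteratedFDeriv ℝ k (f t) x‖ ≤ C ∧
            ‖iteratedFDeriv ℝ k (timeDerivWithin (Icc 0 T) u t) x‖ ≤ C

/-! ### Proved corollaries -/

/-- The forced pressure normalisation specialises, for `f = 0`, to the tree's homogeneous fact
`tao_pressure_normalisation` (Lemma 4.1 (i) with `f = 0`). PROVED from the named fact.
[cite: Tao2011, Lemma 4.1 (i) (arXiv Lemma 25 (i)), p. 14] -/
theorem tao2011_forced_pressure_normalisation.force_zero
    (h : tao2011_forced_pressure_normalisation) : tao_pressure_normalisation := by
  intro ν T hν hT u p hsol hE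
  have hf : IsSmoothSpaceTimeOn (Icc 0 T) (0 : ℝ → ℝ³ → ℝ³) := contDiffOn_const
  have hfE : ∫⁻ t in Icc 0 T, (∫⁻ x, ‖(0 : ℝ → ℝ³ → ℝ³) t x‖ₑ ^ 2) ^ (1 / 2 : ℝ) < ⊤ := by
    simp
  obtain ⟨C, hCtop, hC⟩ := hE
  have hE' : ∃ C : ℝ≥0, ∀ t ∈ Icc 0 T, ∫⁻ x, ‖u t x‖ₑ ^ 2 ≤ C :=
    ⟨C.toNNReal, fun t ht ↦ (hC t ht).trans (ENNReal.coe_toNNReal hCtop.ne).ge⟩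
  obtain ⟨Cf, hCm, hCb, hae⟩ := h hν hT hsol hf hfE hE'
  refine ⟨Cf, hCm, hCb, ?_⟩
  filter_upwards [hae] with t ht x
  simpa using ht x

/-- Per-time corollary of the forced Lemma 4.1 (i): for a.e. `t ∈ [0,T]` the given pressure is the
forced normalised pressure up to a constant. PROVED from the named fact.
[cite: Tao2011, Lemma 4.1 (i) (arXiv Lemma 25 (i)), p. 14] -/
theorem tao2011_forced_pressure_normalisation.ae_eq_add_const
    (h : tao2011_forced_pressure_normalisation) {ν T : ℝ} (hν : 0 < ν) (hT : 0 < T)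
    {f u : ℝ → ℝ³ → ℝ³} {p : ℝ → ℝ³ → ℝ} (hsol : IsClassicalNSSolutionOn (Icc 0 T) ν f u p)
    (hf : IsSmoothSpaceTimeOn (Icc 0 T) f)
    (hfE : ∫⁻ t in Icc 0 T, (∫⁻ x, ‖f t x‖ₑ ^ 2) ^ (1 / 2 : ℝ) < ⊤)
    (hE : ∃ C : ℝ≥0, ∀ t ∈ Icc 0 T, ∫⁻ x, ‖u t x‖ₑ ^ 2 ≤ C) :
    ∀ᵐ t ∂(volume.restrict (Icc 0 T)), ∃ c : ℝ, ∀ x,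
      p t x = normalisedPressure (u t) x + forcePotential (f t) x + c := by
  obtain ⟨C, -, -, hae⟩ := h hν hT hsol hf hfE hE
  filter_upwards [hae] with t ht
  exact ⟨C t, ht⟩

/-- The corrected statement asserts nothing beyond the verbatim one: it is implied by it (drop the
boundedness conjunct). Recorded only as the faithfulness certificate of the correction — the
hypothesis is refuted (`not_tao2011_forced_pressure_normalisation`), so this implication carries no
information about `tao2011_forced_pressure_normalisation_ae` itself.
[cite: Tao2011, Lemma 4.1 (i) (arXiv Lemma 25 (i)), p. 14] -/
theorem tao2011_forced_pressure_normalisation_ae.of_verbatim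
    (h : tao2011_forced_pressure_normalisation) : tao2011_forced_pressure_normalisation_ae := by
  intro ν T hν hT f u p hsol hf hfE hE
  obtain ⟨C, hCm, -, hae⟩ := h hν hT hsol hf hfE hE
  exact ⟨C, hCm, hae⟩

/-- Per-time corollary of the corrected forced Lemma 4.1 (i): for a.e. `t ∈ [0,T]` the given
pressure is the forced normalised pressure up to a constant (in particular `∇p(t) = ∇p₀(t)` for
a.e. `t`, the form used downstream). PROVED from the named fact.
[cite: Tao2011, Lemma 4.1 (i) (arXiv Lemma 25 (i)), p. 14] -/
theorem tao2011_forced_pressure_normalisation_ae.ae_eq_add_const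
    (h : tao2011_forced_pressure_normalisation_ae) {ν T : ℝ} (hν : 0 < ν) (hT : 0 < T)
    {f u : ℝ → ℝ³ → ℝ³} {p : ℝ → ℝ³ → ℝ} (hsol : IsClassicalNSSolutionOn (Icc 0 T) ν f u p)
    (hf : IsSmoothSpaceTimeOn (Icc 0 T) f)
    (hfE : ∫⁻ t in Icc 0 T, (∫⁻ x, ‖f t x‖ₑ ^ 2) ^ (1 / 2 : ℝ) < ⊤)
    (hE : ∃ C : ℝ≥0, ∀ t ∈ Icc 0 T, ∫⁻ x, ‖u t x‖ₑ ^ 2 ≤ C) :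
    ∀ᵐ t ∂(volume.restrict (Icc 0 T)), ∃ c : ℝ, ∀ x,
      p t x = normalisedPressure (u t) x + forcePotential (f t) x + c := by
  obtain ⟨C, -, hae⟩ := h hν hT hsol hf hfE hE
  filter_upwards [hae] with t ht
  exact ⟨C t, ht⟩

/-- The `f = 0` case of the corrected forced fact FOLLOWS from the tree's homogeneous fact
`tao_pressure_normalisation` (Lemma 4.1 (i) with `f = 0`; PROVED in the tree,
`NormalisedPressureDischarge.lean`): non-vacuity of the corrected statement on the homogeneous
subclass. [cite: Tao2011, Lemma 4.1 (i) (arXiv Lemma 25 (i)), p. 14] -/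
theorem tao2011_forced_pressure_normalisation_ae.force_zero_of_homogeneous
    (h : tao_pressure_normalisation) {ν T : ℝ} (hν : 0 < ν) (hT : 0 < T)
    {u : ℝ → ℝ³ → ℝ³} {p : ℝ → ℝ³ → ℝ} (hsol : IsClassicalNSSolutionOn (Icc 0 T) ν 0 u p)
    (hE : ∃ C : ℝ≥0, ∀ t ∈ Icc 0 T, ∫⁻ x, ‖u t x‖ₑ ^ 2 ≤ C) :
    ∃ C : ℝ → ℝ, Measurable C ∧
      ∀ᵐ t ∂(volume.restrict (Icc 0 T)), ∀ x,
        p t x = normalisedPressure (u t) x + forcePotential ((0 : ℝ → ℝ³ → ℝ³) t) x + C t := by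
  obtain ⟨A, hA⟩ := hE
  have hE' : ∃ A : ℝ≥0∞, A < ⊤ ∧ ∀ t ∈ Icc 0 T, ∫⁻ x, ‖u t x‖ₑ ^ 2 ≤ A :=
    ⟨A, ENNReal.coe_lt_top, hA⟩
  obtain ⟨C, hCm, -, hae⟩ := h ν T hν hT u p hsol hE'
  refine ⟨C, hCm, ?_⟩
  filter_upwards [hae] with t ht x
  simpa using ht x

/-- **Cor. 11.4 (arXiv Cor. 71) WITH force, as printed**: under the hypotheses of the velocity
form and, in addition, with BOTH pressures normalised ((9): `HasForcedNormalisedPressure`), the two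
solutions `(u,p)`, `(v,q)` coincide on `[0,T] × ℝ³` — velocities AND pressures ("at most one almost
smooth finite energy solution `(u,p,u₀,f,T)` … with normalised pressure"). PROVED from the
velocity form (the pressures are then the same function of the common velocity).
[cite: Tao2011, Cor. 11.4 (arXiv Cor. 71), p. 36] -/
theorem tao2011_forced_unconditionalUniqueness_of_velocity
    (h : tao2011_forced_unconditionalUniqueness_velocity) {ν T : ℝ} (hν : 0 < ν) (hT : 0 < T)
    {f : ℝ → ℝ³ → ℝ³} (hf : IsSmoothSpaceTimeOn (Icc 0 T) f)
    (hfH1 : ∀ j ≤ 1, ∃ C : ℝ≥0, ∀ t ∈ Icc 0 T, ∫⁻ x, ‖iteratedFDeriv ℝ j (f t) x‖ₑ ^ 2 ≤ C)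
    {u v : ℝ → ℝ³ → ℝ³} {p q : ℝ → ℝ³ → ℝ}
    (hu : IsClassicalNSSolutionOn (Icc 0 T) ν f u p) (hv : IsClassicalNSSolutionOn (Icc 0 T) ν f v q)
    (h₀ : ∀ j ≤ 1, ∫⁻ x, ‖iteratedFDeriv ℝ j (u 0) x‖ₑ ^ 2 < ⊤) (hdatum : v 0 = u 0)
    (huE : ∃ C : ℝ≥0, ∀ t ∈ Icc 0 T, ∫⁻ x, ‖u t x‖ₑ ^ 2 ≤ C)
    (hvE : ∃ C : ℝ≥0, ∀ t ∈ Icc 0 T, ∫⁻ x, ‖v t x‖ₑ ^ 2 ≤ C)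
    (hup : HasForcedNormalisedPressure u f p (Icc 0 T))
    (hvq : HasForcedNormalisedPressure v f q (Icc 0 T)) :
    (∀ t ∈ Icc 0 T, v t = u t) ∧ ∀ t ∈ Icc 0 T, q t = p t := by
  have hvel := h hν hT hf hfH1 hu hv h₀ hdatum huE hvE
  refine ⟨hvel, fun t ht ↦ ?_⟩
  funext x
  rw [hvq t ht x, hup t ht x, hvel t ht]

/-- The `f = 0` case of the forced velocity form is the tree's homogeneous velocity form
`tao_unconditional_uniqueness_velocity` (Cor. 11.4 with `f = 0`). PROVED from the named fact.
[cite: Tao2011, Cor. 11.4 (arXiv Cor. 71), p. 36] -/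
theorem tao2011_forced_unconditionalUniqueness_velocity.force_zero
    (h : tao2011_forced_unconditionalUniqueness_velocity) : tao_unconditional_uniqueness_velocity := by
  intro ν T hν hT u₀ h0 h1 u v p q hu hv hu0 hv0 hEu hEv t ht
  have hf : IsSmoothSpaceTimeOn (Icc 0 T) (0 : ℝ → ℝ³ → ℝ³) := contDiffOn_const
  have hfH1 : ∀ j ≤ 1, ∃ C : ℝ≥0, ∀ t ∈ Icc 0 T,
      ∫⁻ x, ‖iteratedFDeriv ℝ j ((0 : ℝ → ℝ³ → ℝ³) t) x‖ₑ ^ 2 ≤ C := by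
    intro j _
    refine ⟨0, fun t _ ↦ ?_⟩
    simp [Pi.zero_def]
  -- `H¹` datum: `u₀, ∇u₀ ∈ L²` in the `iteratedFDeriv` form
  have key : ∀ {F : Type} [NormedAddCommGroup F] {g : ℝ³ → F}, MemLp g 2 volume →
      ∫⁻ x, ‖g x‖ₑ ^ 2 < ⊤ := by
    intro F _ g hg
    have := lintegral_rpow_enorm_lt_top_of_eLpNorm_lt_top (by norm_num : (2 : ℝ≥0∞) ≠ 0)
      (by norm_num : (2 : ℝ≥0∞) ≠ ⊤) hg.eLpNorm_lt_top
    simpa [ENNReal.rpow_two] using this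
  have h₀ : ∀ j ≤ 1, ∫⁻ x, ‖iteratedFDeriv ℝ j (u 0) x‖ₑ ^ 2 < ⊤ := by
    intro j hj
    rw [hu0]
    interval_cases j
    · have e : (fun x ↦ ‖iteratedFDeriv ℝ 0 u₀ x‖ₑ ^ 2) = fun x ↦ ‖u₀ x‖ₑ ^ 2 := by
        funext x; rw [← ofReal_norm, norm_iteratedFDeriv_zero, ofReal_norm]
      rw [e]; exact key h0
    · have e : (fun x ↦ ‖iteratedFDeriv ℝ 1 u₀ x‖ₑ ^ 2) = fun x ↦ ‖fderiv ℝ u₀ x‖ₑ ^ 2 := by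
        funext x; rw [← ofReal_norm, norm_iteratedFDeriv_one, ofReal_norm]
      rw [e]; exact key h1
  have hEu' : ∃ C : ℝ≥0, ∀ t ∈ Icc 0 T, ∫⁻ x, ‖u t x‖ₑ ^ 2 ≤ C := by
    obtain ⟨C, hC, hb⟩ := hEu
    exact ⟨C.toNNReal, fun t ht ↦ (hb t ht).trans (ENNReal.coe_toNNReal hC.ne).ge⟩
  have hEv' : ∃ C : ℝ≥0, ∀ t ∈ Icc 0 T, ∫⁻ x, ‖v t x‖ₑ ^ 2 ≤ C := by
    obtain ⟨C, hC, hb⟩ := hEv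
    exact ⟨C.toNNReal, fun t ht ↦ (hb t ht).trans (ENNReal.coe_toNNReal hC.ne).ge⟩
  have hdatum : v 0 = u 0 := by rw [hv0, hu0]
  exact (h hν hT hf hfH1 hu hv h₀ hdatum hEu' hEv' t ht).symm

/-! ### Lemma 8.1 (arXiv Lemma 44) with force: the global energy inequality -/

/-- **Tao 2011, Lemma 8.1 (arXiv Lemma 44), global energy inequality, WITH force.** Printed: "Let
`(u,p,u₀,f,T)` be a finite energy almost smooth solution. Then
`‖u‖_{L^∞_t L²_x([0,T] × ℝ³)} + ‖∇u‖_{L²_t L²_x([0,T] × ℝ³)} ≲ E(u₀,f,T)^{1/2}`. In particular, `u`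
lies in the space `X¹([0,T] × ℝ³)`", where `E(u₀,f,T) := ½(‖u₀‖_{L²_x(ℝ³)} + ‖f‖_{L¹_t L²_x([0,T] × ℝ³)})²`
((8), p. 3) and the implied constant is absolute (in particular independent of the a priori bound
`‖u‖_{L^∞_t L²_x}`, (56)). Rendered exactly as the tree's homogeneous twin
`tao_finite_energy_smooth_energy_bound` (PROVED, `NSFiniteEnergySmoothProofs.lean`), which is its case
`f = 0` (`tao2011_forced_finiteEnergy_energyBound.force_zero`): `ν = 1` in print, a general `ν > 0` by
the rescaling `v(s,y) = ν⁻¹u(s/ν,y)`, `g(s,y) = ν⁻²f(s/ν,y)` (so `‖g‖_{L¹_s L²_y([0,νT])} = ν⁻¹‖f‖_{L¹_t L²_x([0,T])}`),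
under which the printed bound, squared, reads
`sup_{t ∈ [0,T]} ∫|u(t)|² + ν ∫₀ᵀ∫|∇u|² ≤ C ((∫|u₀|²)^{1/2} + ∫₀ᵀ (∫|f(t)|²)^{1/2} dt)²`; classical
solutions jointly smooth on the CLOSED slab `[0,T] × ℝ³` (a subclass of almost smooth solutions), smooth
force of finite `L¹_t L²_x` norm (finite energy data, (6)), `sup_t ∫|u(t)|² < ∞` ((7)); lower Lebesgue
integrals, dissipation density `frobeniusNormSq (fderiv ℝ (u t) x) = |∇u(t,x)|²`. Special case of the
printed lemma. Nothing asserted.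
[cite: Tao2011, Lemma 8.1 (arXiv Lemma 44) p. 24, with (6)–(8) p. 3] -/
def tao2011_forced_finiteEnergy_energyBound : Prop :=
  ∃ C : ℝ≥0∞, C < ⊤ ∧
    ∀ ⦃ν T : ℝ⦄ (_hν : 0 < ν) (_hT : 0 < T) ⦃f u : ℝ → ℝ³ → ℝ³⦄ ⦃p : ℝ → ℝ³ → ℝ⦄
      (_hsol : IsClassicalNSSolutionOn (Icc 0 T) ν f u p)
      (_hf : IsSmoothSpaceTimeOn (Icc 0 T) f)
      (_hfE : ∫⁻ t in Icc 0 T, (∫⁻ x, ‖f t x‖ₑ ^ 2) ^ (1 / 2 : ℝ) < ⊤)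
      (_hE : ∃ A : ℝ≥0, ∀ t ∈ Icc 0 T, ∫⁻ x, ‖u t x‖ₑ ^ 2 ≤ A),
      (∀ t ∈ Icc 0 T, ∫⁻ x, ‖u t x‖ₑ ^ 2 ≤
          C * ((∫⁻ x, ‖u 0 x‖ₑ ^ 2) ^ (1 / 2 : ℝ) +
            ∫⁻ t in Icc 0 T, (∫⁻ x, ‖f t x‖ₑ ^ 2) ^ (1 / 2 : ℝ)) ^ 2) ∧
        ENNReal.ofReal ν *
            ∫⁻ t in Ioo 0 T, ∫⁻ x, ENNReal.ofReal (frobeniusNormSq (fderiv ℝ (u t) x)) ≤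
          C * ((∫⁻ x, ‖u 0 x‖ₑ ^ 2) ^ (1 / 2 : ℝ) +
            ∫⁻ t in Icc 0 T, (∫⁻ x, ‖f t x‖ₑ ^ 2) ^ (1 / 2 : ℝ)) ^ 2

/-- **`f = 0`: the forced fact implies the tree's homogeneous fact** `tao_finite_energy_smooth_energy_bound`
(Lemma 8.1 with `f = 0`, where `E(u₀,0,T) = ½‖u₀‖²_{L²}`). PROVED from the named fact.
[cite: Tao2011, Lemma 8.1 (arXiv Lemma 44) p. 24] -/
theorem tao2011_forced_finiteEnergy_energyBound.force_zero
    (h : tao2011_forced_finiteEnergy_energyBound) : tao_finite_energy_smooth_energy_bound := by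
  obtain ⟨C, hC, H⟩ := h
  refine ⟨C, hC, fun ν T hν hT u p hsol hE ↦ ?_⟩
  have hf : IsSmoothSpaceTimeOn (Icc 0 T) (0 : ℝ → ℝ³ → ℝ³) := contDiffOn_const
  have hfE : ∫⁻ t in Icc 0 T, (∫⁻ x, ‖(0 : ℝ → ℝ³ → ℝ³) t x‖ₑ ^ 2) ^ (1 / 2 : ℝ) < ⊤ := by
    simp
  have hE' : ∃ A : ℝ≥0, ∀ t ∈ Icc 0 T, ∫⁻ x, ‖u t x‖ₑ ^ 2 ≤ A := by
    obtain ⟨A, hA, hb⟩ := hE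
    exact ⟨A.toNNReal, fun t ht ↦ (hb t ht).trans (ENNReal.coe_toNNReal hA.ne).ge⟩
  have key := H hν hT hsol hf hfE hE'
  have e : ((∫⁻ x, ‖u 0 x‖ₑ ^ 2) ^ (1 / 2 : ℝ) +
      ∫⁻ t in Icc 0 T, (∫⁻ x, ‖(0 : ℝ → ℝ³ → ℝ³) t x‖ₑ ^ 2) ^ (1 / 2 : ℝ)) ^ 2 =
        ∫⁻ x, ‖u 0 x‖ₑ ^ 2 := by
    have hz : ∫⁻ t in Icc 0 T, (∫⁻ x, ‖(0 : ℝ → ℝ³ → ℝ³) t x‖ₑ ^ 2) ^ (1 / 2 : ℝ) = 0 := by simp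
    rw [hz, add_zero, ← ENNReal.rpow_two, ← ENNReal.rpow_mul]
    norm_num
  rw [e] at key
  exact key

end Literature.Analysis.FluidPDE

end
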